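import Mathlib
import Summits.CriticalPhenomena.Ising3DConformalLimit.Theses.ArmHyperscaling
import Summits.CriticalPhenomena.Ising3DConformalLimit.Theses.MirrorHoelderCompactness

/-!
# Sketch (strategist s1, instance ConformalPoissonDevice) — the ONE-ARM TRANSFER edge for child 6150

`OneArmHyperscaling` (item 15591, route ArmHyperscaling) ∧ `OneArmDoubling` ⟹ `TwoPointDoubling` (item 6150),
and `OneArmHyperscaling` ∧ `TwoPointDoubling` ⟹ `OneArmDoubling` (along the sublattice `K·ℕ`), modulo
Tasaki's hyperscaling inequality `g(3k e₀) ≤ (m⁺_k)²` (GKS decoupling; cited as `stub_oneArmConverse` of the QT line).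
Only the ABSTRACT real-inequality cores are proved here; the lattice statements are typed.
-/

namespace H21Sketch.InstCPD

open Literature.Probability.LatticeModels

/-- plus-box centre magnetisation at `β_c(3)`, box `Λ_L = box 3 L`. -/
noncomputable def mPlus (L : ℕ) : ℝ :=
  isingCorr (zdGraph 3) (box 3 L) (criticalBeta 3) 0 BoundaryCondition.plus ({0} : Finset (Site 3))

/-- axis two-point function `g(n) = ⟨σ₀σ_{n e₀}⟩_{β_c(3)}`. -/
noncomputable def g (n : ℕ) : ℝ := criticalTwoPoint 3 (Pi.single 0 (n : ℤ))

/-- ONE-ARM DOUBLING (OAD): the critical plus-box magnetisation at the centre does not drop by more than a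
constant factor when the box is enlarged by a fixed ratio. -/
def OneArmDoubling : Prop :=
  ∃ K : ℕ, 1 ≤ K ∧ ∃ D : ℝ, ∀ L : ℕ, 1 ≤ L → mPlus L ≤ D * mPlus (K * L)

/-- Tasaki 1987 in axis form (GKS: plus b.c. on two disjoint boxes of radius `k` around `0` and `3k e₀`). -/
def TasakiAxis : Prop := ∀ k : ℕ, 1 ≤ k → g (3 * k) ≤ (mPlus k) ^ 2

/-- item 15591 read through `mPlus`/`g` (same body as `Theses.ArmHyperscaling.OneArmHyperscaling`). -/
theorem oneArmHyperscaling_iff :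
    Summit.CriticalPhenomena.Ising3DConformalLimit.Theses.ArmHyperscaling.OneArmHyperscaling ↔
      ∃ K : ℕ, 1 ≤ K ∧ ∃ C : ℝ, ∀ n : ℕ, 1 ≤ n → (mPlus (K * n)) ^ 2 ≤ C * g (2 * n) :=
  Iff.rfl

/-- item 6150 read through `g`. -/
theorem twoPointDoubling_iff :
    Summit.CriticalPhenomena.Ising3DConformalLimit.Theses.MirrorHoelderCompactness.TwoPointDoubling ↔
      ∃ κ : ℝ, 0 < κ ∧ ∀ n : ℕ, 1 ≤ n → κ * g n ≤ g (2 * n) :=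
  Iff.rfl

/-! ## Abstract cores (proved) -/

/-- CORE 1: Tasaki + one-arm hyperscaling (ratio `K`, constant `C`) + one-arm doubling at ratio `3K`
(constant `D`) give doubling of `g` along the scales `3k ↦ 6k`. -/
theorem core_doubling_of_oneArm (g m : ℕ → ℝ) (C D : ℝ) (K : ℕ)
    (hC : 0 ≤ C) (hm : ∀ L, 0 ≤ m L)
    (hT : ∀ k, 1 ≤ k → g (3 * k) ≤ (m k) ^ 2)
    (hOA : ∀ n, 1 ≤ n → (m (K * n)) ^ 2 ≤ C * g (2 * n))
    (hD : ∀ L, 1 ≤ L → m L ≤ D * m (3 * K * L)) :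
    ∀ k, 1 ≤ k → g (3 * k) ≤ C * D ^ 2 * g (2 * (3 * k)) := by
  intro k hk
  have h1 : g (3 * k) ≤ (m k) ^ 2 := hT k hk
  have h2 : m k ≤ D * m (3 * K * k) := hD k hk
  have h3 : (m k) ^ 2 ≤ (D * m (3 * K * k)) ^ 2 := by
    apply pow_le_pow_left₀ (hm k) h2
  have hKk : K * (3 * k) = 3 * K * k := by ring
  have h4 : (m (3 * K * k)) ^ 2 ≤ C * g (2 * (3 * k)) := by
    have := hOA (3 * k) (by omega)
    rwa [hKk] at this
  calc g (3 * k) ≤ (m k) ^ 2 := h1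
    _ ≤ (D * m (3 * K * k)) ^ 2 := h3
    _ = D ^ 2 * (m (3 * K * k)) ^ 2 := by ring
    _ ≤ D ^ 2 * (C * g (2 * (3 * k))) := by
        apply mul_le_mul_of_nonneg_left h4 (sq_nonneg D)
    _ = C * D ^ 2 * g (2 * (3 * k)) := by ring

/-- CORE 2 (converse direction): Tasaki + one-arm hyperscaling + doubling of `g` iterated to cover the
ratio `6K` give one-arm doubling along the sublattice `K·ℕ` (ratio `2`): `m (K L)² ≤ C·E·m (2 K L)²`.
Here `hdbl6K : g (2L) ≤ E * g (3·(2KL))` packages "doubling iterated ⌈log₂ 3K⌉ times + axis antitonicity"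
(both in tree for `criticalTwoPoint`). -/
theorem core_oneArmDoubling_of_doubling (g m : ℕ → ℝ) (C E : ℝ) (K : ℕ)
    (hC : 0 ≤ C) (hE : 0 ≤ E)
    (hT : ∀ k, 1 ≤ k → g (3 * k) ≤ (m k) ^ 2)
    (hOA : ∀ n, 1 ≤ n → (m (K * n)) ^ 2 ≤ C * g (2 * n))
    (hdbl6K : ∀ L, 1 ≤ L → g (2 * L) ≤ E * g (3 * (2 * K * L))) (hK : 1 ≤ K) :
    ∀ L, 1 ≤ L → (m (K * L)) ^ 2 ≤ C * E * (m (2 * K * L)) ^ 2 := by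
  intro L hL
  have h1 : (m (K * L)) ^ 2 ≤ C * g (2 * L) := hOA L hL
  have h2 : g (2 * L) ≤ E * g (3 * (2 * K * L)) := hdbl6K L hL
  have h3 : g (3 * (2 * K * L)) ≤ (m (2 * K * L)) ^ 2 := hT (2 * K * L) (by nlinarith)
  calc (m (K * L)) ^ 2 ≤ C * g (2 * L) := h1
    _ ≤ C * (E * g (3 * (2 * K * L))) := mul_le_mul_of_nonneg_left h2 hC
    _ ≤ C * (E * (m (2 * K * L)) ^ 2) := by
        apply mul_le_mul_of_nonneg_left _ hC
        exact mul_le_mul_of_nonneg_left h3 hE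
    _ = C * E * (m (2 * K * L)) ^ 2 := by ring

/-- CORE 1 at the lattice objects: `TasakiAxis ∧ OneArmHyperscaling ∧ (one-arm doubling at ratio 3K, the K of OA)`
⟹ doubling of the critical axis two-point function along `3k ↦ 6k` (the remaining interpolation to all `n` is the
tree's eventual/dyadic-doubling ⟺ 6150 machinery, `Funnel.LogConvexSeq`, p132478). -/
theorem axisDoubling_threeMultiples_of_oneArm
    (hT : TasakiAxis)
    (K : ℕ) (C : ℝ) (hC : 0 ≤ C) (hOA : ∀ n : ℕ, 1 ≤ n → (mPlus (K * n)) ^ 2 ≤ C * g (2 * n))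
    (D : ℝ) (hD : ∀ L : ℕ, 1 ≤ L → mPlus L ≤ D * mPlus (3 * K * L))
    (hm : ∀ L, 0 ≤ mPlus L) :
    ∀ k : ℕ, 1 ≤ k → g (3 * k) ≤ C * D ^ 2 * g (2 * (3 * k)) :=
  core_doubling_of_oneArm g mPlus C D K hC hm hT hOA hD

end H21Sketch.InstCPD
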